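import Mathlib
import HarnessLib
import Summits.Ventures.LatticeQCDFlow.Scoring.RegenerativeCLT
import Summits.Ventures.LatticeQCDFlow.Scoring.RegenerativeVarianceEstimatorPlugIn

/-!
# Studentised regenerative CLT: with the plug-in tour variance `V̂_R` and the mean tour length
# `N̄_R` in place of the unknown `σ²_f` and `1/e`, `√R (Â_R − π f) N̄_R / √V̂_R ⇒ N(0, 1)` — the
# Mykland–Tierney–Yu interval `Â_R ± z √V̂_R / (N̄_R √R)` has asymptotically exact coverage

HONEST FRAMING: exact (Metropolis-corrected) sampling algorithms for lattice gauge theory;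
figures of merit are autocorrelation/cost numbers at stated couplings and volumes; no
continuum-physics claim.

Venture `LatticeQCDFlow` (cell pub-lqcd), topic `Scoring`; FANOUT row 8 (`s0-cpn-nemc`, GEN-18).
NEW WORK of the cell, not a published result; no definition is introduced.  Notation of
`Scoring/RegenerativeCLT.lean` and `Scoring/RegenerativeVarianceEstimatorPlugIn.lean`: tours
`1, …, R` of the split chain from ANY initial law, `Y_i, N_i` tour sums and lengths,
`Â_R = Σ Y_i / Σ N_i`, `N̄_R = Σ N_i / R`, `V̂_R = (1/R) Σ (Y_i − Â_R N_i)²` the COMPUTABLE plug-in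
tour variance, `c = π(f)`, `e = ε.toReal`, `σ²_f` the Green–Kubo asymptotic variance, `v = σ²_f / e`
the tour variance.  Everything in the statistic
`T_R := √R (Â_R − c) · N̄_R / √V̂_R` is computable from the run except `c` — so `{|T_R| ≤ z}` is the
event "the interval `Â_R ± z √V̂_R /(N̄_R √R)` covers `π(f)`" (`/` is Mathlib's total
division: on the event `V̂_R = 0`, whose probability tends to `0`, `T_R` takes the junk value `0` —
immaterial for limits in distribution).  Results (for `σ²_f > 0`):
(i) `V̂_R → v` in probability (from the CLT-free rate of the parent file); (ii) `T_R ⇒ N(0, 1)` from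
any start (the centred-tour-sum CLT, Slutsky with the continuous map `(a, w) ↦ a/√(max(w, v/4))`,
and `T_R` differs from that map's value only on `{V̂_R < v/4}`, an event of vanishing probability —
`MeasureTheory.tendstoInDistribution_of_tendstoInMeasure_sub`); (iii) by the portmanteau theorem
the coverage probability `P̂(|T_R| ≤ z)` converges to `N(0,1)([−z, z])` for every `z > 0`.
Printed counterpart NAMED ONLY: Mykland–Tierney–Yu 1995 §3 (the regenerative standard error);
Hobert–Jones–Presnell–Rosenthal 2002 Thm 2; Jones–Haran–Caffo–Neath 2006 §3.2 — nothing is cited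
as a fact.

## Content (`π` invariant, `0 < ε < 1`, `|f| ≤ C` measurable, any initial law)

* **`regenerative_variance_plugIn_tendstoInMeasure`** — `V̂_R → σ²_f / e` in probability;
* **`regenerative_studentized_clt`** — `σ²_f > 0`: `T_R ⇒ Y` for any `Y` with law `N(0, 1)`;
* **`regenerative_studentized_coverage`** — `σ²_f > 0`, `z > 0`:
  `P̂(|T_R| ≤ z) → (gaussianReal 0 1)[−z, z]`.

NOT CLAIMED: a rate (Berry–Esseen / Edgeworth); the degenerate case `σ²_f = 0`; unbounded `f`;
any `ε` of a concrete sampler.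
-/

noncomputable section

namespace Summit.Ventures.LatticeQCDFlow.Scoring

open MeasureTheory ProbabilityTheory Filter Finset Preorder Literature.Probability.MarkovChains
open scoped ENNReal Topology

section Studentized

variable {Ω : Type*} [MeasurableSpace Ω]
  {κ : Kernel Ω Ω} [IsMarkovKernel κ] {ν : Measure Ω} [IsProbabilityMeasure ν] {ε : ℝ≥0∞}
  {hmin : ∀ x {B : Set Ω}, MeasurableSet B → ε * ν B ≤ κ x B}
  (κs : Kernel (Ω × Bool) (Ω × Bool)) [IsMarkovKernel κs]
  (μs : Measure (Ω × Bool)) [IsProbabilityMeasure μs]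

/-- **THE PLUG-IN TOUR VARIANCE IS CONSISTENT (in probability)**: `π` invariant, `0 < ε < 1`,
`|f| ≤ C` measurable, any initial law: `V̂_R = (1/R) Σ_{i<R} (Y_{i+1} − Â_R N_{i+1})² → σ²_f / e`
in probability as `R → ∞`. -/
theorem regenerative_variance_plugIn_tendstoInMeasure {π : Measure Ω} [IsProbabilityMeasure π]
    (hπ : Kernel.Invariant κ π) (hε0 : 0 < ε) (hε : ε < 1)
    (hκs : ∀ p, κs p = (ε • ν).map (fun y : Ω => (y, true))
      + ((1 - ε) • Doeblin.residualKernel κ ν ε hmin p.1).map (fun y : Ω => (y, false)))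
    {f : Ω → ℝ} (hf : Measurable f) {C : ℝ} (hC : ∀ x, |f x| ≤ C) :
    TendstoInMeasure (Kernel.trajMeasure (X := fun _ : ℕ => Ω × Bool) μs
        (fun m : ℕ => κs.comap (fun h : (i : ↥(Finset.Iic m)) → Ω × Bool =>
          h ⟨m, Finset.mem_Iic.2 le_rfl⟩) (measurable_pi_apply _)))
      (fun (R : ℕ) (x : ℕ → Ω × Bool) => ((∑ i ∈ Finset.range R, ((∑' u, (if (∑ s ∈ Finset.range u, (if (x (s + 1)).2 then (1 : ℕ) else 0)) = i + 1 then (1 : ℝ) else 0) * f (x u).1) - ((∑ i ∈ Finset.range R, (∑' u, (if (∑ s ∈ Finset.range u, (if (x (s + 1)).2 then (1 : ℕ) else 0)) = i + 1 then (1 : ℝ) else 0) * f (x u).1)) / (∑ i ∈ Finset.range R, (∑' u, (if (∑ s ∈ Finset.range u, (if (x (s + 1)).2 then (1 : ℕ) else 0)) = i + 1 then (1 : ℝ) else 0)))) * (∑' u, (if (∑ s ∈ Finset.range u, (if (x (s + 1)).2 then (1 : ℕ) else 0)) = i + 1 then (1 : ℝ) else 0))) ^ 2) / R))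
      atTop (fun _ => ((∫ y, (f y - ∫ z, f z ∂π) ^ 2 ∂π)
      + 2 * ∑' k, ∫ y, (f y - ∫ z, f z ∂π) * (kop κ)^[k + 1] (fun y => f y - ∫ z, f z ∂π) y ∂π) / ε.toReal) := by
  haveI hνt : IsProbabilityMeasure (ν.map (fun y : Ω => (y, true))) :=
    Measure.isProbabilityMeasure_map (measurable_tagCoin true).aemeasurable
  set P := (Kernel.trajMeasure (X := fun _ : ℕ => Ω × Bool) μs
        (fun m : ℕ => κs.comap (fun h : (i : ↥(Finset.Iic m)) → Ω × Bool =>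
          h ⟨m, Finset.mem_Iic.2 le_rfl⟩) (measurable_pi_apply _))) with hP
  set c := ∫ z, f z ∂π with hc
  set σ2 := ((∫ y, (f y - ∫ z, f z ∂π) ^ 2 ∂π)
      + 2 * ∑' k, ∫ y, (f y - ∫ z, f z ∂π) * (kop κ)^[k + 1] (fun y => f y - ∫ z, f z ∂π) y ∂π) with hσ2
  set v := ∫ y, (∑' u, (if (∑ s ∈ Finset.range u, (if (y (s + 1)).2 then (1 : ℕ) else 0)) = 0 then (1 : ℝ) else 0) * (f (y u).1 - ∫ z, f z ∂π)) ^ 2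
      ∂(Kernel.trajMeasure (X := fun _ : ℕ => Ω × Bool) (ν.map (fun y : Ω => (y, true)))
        (fun m : ℕ => κs.comap (fun h : (i : ↥(Finset.Iic m)) → Ω × Bool =>
          h ⟨m, Finset.mem_Iic.2 le_rfl⟩) (measurable_pi_apply _))) with hv
  have he0 : 0 < ε.toReal := ENNReal.toReal_pos hε0.ne' (ne_top_of_lt hε)
  have hvσ : σ2 / ε.toReal = v := by
    rw [div_eq_iff he0.ne', mul_comm]
    exact (splitChain_fresh_sq_centredTourSum_eq_greenKubo κs (κ := κ) (ν := ν) (hmin := hmin) hπ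
      hε0 hε hκs hf hC).symm
  have hC0 : 0 ≤ C := (abs_nonneg _).trans (hC (Classical.choice (nonempty_of_isProbabilityMeasure π)))
  rw [tendstoInMeasure_iff_measureReal_norm]
  intro η hη
  -- radius bookkeeping: `a = η/2`, `s = min 1 (η e² / (6 (4C + 1)))`
  set s : ℝ := min 1 (η * ε.toReal ^ 2 / (6 * (4 * C + 1))) with hs
  have h4C : 0 < 4 * C + 1 := by linarith
  have hs0 : 0 < s := lt_min one_pos (div_pos (by positivity) (by positivity))
  have hs1 : s ≤ 1 := min_le_left _ _
  have hs2 : s ≤ η * ε.toReal ^ 2 / (6 * (4 * C + 1)) := min_le_right _ _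
  have hrad : η / 2 + 3 * (4 * C * s + s ^ 2) / ε.toReal ^ 2 ≤ η := by
    have h1 : 4 * C * s + s ^ 2 ≤ s * (4 * C + 1) := by nlinarith
    have h2 : 3 * (4 * C * s + s ^ 2) / ε.toReal ^ 2 ≤ 3 * (s * (4 * C + 1)) / ε.toReal ^ 2 :=
      div_le_div_of_nonneg_right (by linarith) (by positivity)
    have h3' : s * (4 * C + 1) ≤ η * ε.toReal ^ 2 / 6 := by
      calc s * (4 * C + 1) ≤ (η * ε.toReal ^ 2 / (6 * (4 * C + 1))) * (4 * C + 1) :=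
            mul_le_mul_of_nonneg_right hs2 h4C.le
        _ = η * ε.toReal ^ 2 / 6 := by field_simp
    have h3 : 3 * (s * (4 * C + 1)) / ε.toReal ^ 2 ≤ η / 2 := by
      rw [div_le_iff₀ (by positivity)]
      linarith
    linarith
  set K : ℝ := (2 * C) ^ 4 * 24 / (ε.toReal ^ 4 * (η / 2) ^ 2) + 24
      + 4 * ((2 - ε.toReal) * (2 * C) ^ 2 / s ^ 2 + (1 - ε.toReal)) with hK
  refine squeeze_zero' (Eventually.of_forall fun R => measureReal_nonneg) ?_
    (tendsto_const_div_atTop_nhds_zero_nat K)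
  filter_upwards [eventually_gt_atTop 0] with R hR
  have hb := regenerative_variance_plugIn_confidence κs μs (κ := κ) (ν := ν) (hmin := hmin) hπ hε0 hε
    hκs hf hC hR (half_pos hη) hs0
  rw [← hP] at hb
  refine le_trans (measureReal_mono ?_) hb
  intro x hx
  simp only [Set.mem_setOf_eq, Real.norm_eq_abs] at hx ⊢
  rw [hvσ] at hx
  exact hrad.trans hx

/-- **THE STUDENTISED REGENERATIVE CLT.**  `π` invariant, `κ(x, ·) ≥ ε ν` (`0 < ε < 1`),
`|f| ≤ C` measurable, `σ²_f > 0`, any initial law; for any real random variable `Y` with law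
`N(0, 1)` on any auxiliary probability space:
`T_R = √R (Â_R − π f) · N̄_R / √V̂_R ⇒ Y` in distribution as `R → ∞`.  (The instance argument
`[IsProbabilityMeasure P̂]` is `inferInstance` at every call site, see
`Scoring/RegenerativeCLT.lean`.) -/
theorem regenerative_studentized_clt {π : Measure Ω} [IsProbabilityMeasure π]
    (hπ : Kernel.Invariant κ π) (hε0 : 0 < ε) (hε : ε < 1)
    (hκs : ∀ p, κs p = (ε • ν).map (fun y : Ω => (y, true))
      + ((1 - ε) • Doeblin.residualKernel κ ν ε hmin p.1).map (fun y : Ω => (y, false)))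
    {f : Ω → ℝ} (hf : Measurable f) {C : ℝ} (hC : ∀ x, |f x| ≤ C)
    (hσ : 0 < ((∫ y, (f y - ∫ z, f z ∂π) ^ 2 ∂π)
      + 2 * ∑' k, ∫ y, (f y - ∫ z, f z ∂π) * (kop κ)^[k + 1] (fun y => f y - ∫ z, f z ∂π) y ∂π))
    {Ω' : Type*} [MeasurableSpace Ω'] {P' : Measure Ω'} [IsProbabilityMeasure P'] {Y : Ω' → ℝ}
    (hY : HasLaw Y (gaussianReal 0 1) P')
    [IsProbabilityMeasure (Kernel.trajMeasure (X := fun _ : ℕ => Ω × Bool) μs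
        (fun m : ℕ => κs.comap (fun h : (i : ↥(Finset.Iic m)) → Ω × Bool =>
          h ⟨m, Finset.mem_Iic.2 le_rfl⟩) (measurable_pi_apply _)))] :
    TendstoInDistribution (fun (R : ℕ) (x : ℕ → Ω × Bool) =>
        Real.sqrt R * (((∑ i ∈ Finset.range R, (∑' u, (if (∑ s ∈ Finset.range u, (if (x (s + 1)).2 then (1 : ℕ) else 0)) = i + 1 then (1 : ℝ) else 0) * f (x u).1)) / (∑ i ∈ Finset.range R, (∑' u, (if (∑ s ∈ Finset.range u, (if (x (s + 1)).2 then (1 : ℕ) else 0)) = i + 1 then (1 : ℝ) else 0)))) - ∫ z, f z ∂π) * ((∑ i ∈ Finset.range R, (∑' u, (if (∑ s ∈ Finset.range u, (if (x (s + 1)).2 then (1 : ℕ) else 0)) = i + 1 then (1 : ℝ) else 0))) / R) / Real.sqrt ((∑ i ∈ Finset.range R, ((∑' u, (if (∑ s ∈ Finset.range u, (if (x (s + 1)).2 then (1 : ℕ) else 0)) = i + 1 then (1 : ℝ) else 0) * f (x u).1) - ((∑ i ∈ Finset.range R, (∑' u, (if (∑ s ∈ Finset.range u, (if (x (s + 1)).2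 then (1 : ℕ) else 0)) = i + 1 then (1 : ℝ) else 0) * f (x u).1)) / (∑ i ∈ Finset.range R, (∑' u, (if (∑ s ∈ Finset.range u, (if (x (s + 1)).2 then (1 : ℕ) else 0)) = i + 1 then (1 : ℝ) else 0)))) * (∑' u, (if (∑ s ∈ Finset.range u, (if (x (s + 1)).2 then (1 : ℕ) else 0)) = i + 1 then (1 : ℝ) else 0))) ^ 2) / R))
      atTop Y (fun _ => (Kernel.trajMeasure (X := fun _ : ℕ => Ω × Bool) μs
        (fun m : ℕ => κs.comap (fun h : (i : ↥(Finset.Iic m)) → Ω × Bool =>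
          h ⟨m, Finset.mem_Iic.2 le_rfl⟩) (measurable_pi_apply _)))) P' := by
  haveI hνt : IsProbabilityMeasure (ν.map (fun y : Ω => (y, true))) :=
    Measure.isProbabilityMeasure_map (measurable_tagCoin true).aemeasurable
  set P := (Kernel.trajMeasure (X := fun _ : ℕ => Ω × Bool) μs
        (fun m : ℕ => κs.comap (fun h : (i : ↥(Finset.Iic m)) → Ω × Bool =>
          h ⟨m, Finset.mem_Iic.2 le_rfl⟩) (measurable_pi_apply _))) with hP
  set c := ∫ z, f z ∂π with hc
  set σ2 := ((∫ y, (f y - ∫ z, f z ∂π) ^ 2 ∂π)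
      + 2 * ∑' k, ∫ y, (f y - ∫ z, f z ∂π) * (kop κ)^[k + 1] (fun y => f y - ∫ z, f z ∂π) y ∂π) with hσ2
  have he0 : 0 < ε.toReal := ENNReal.toReal_pos hε0.ne' (ne_top_of_lt hε)
  have hv0 : 0 < σ2 / ε.toReal := div_pos hσ he0
  have hsv : Real.sqrt (σ2 / ε.toReal) ≠ 0 := (Real.sqrt_pos.2 hv0).ne'
  obtain ⟨hg, -, -⟩ := centred_observable_bounds π hf hC
  -- measurability of the pieces
  have hYm : ∀ i : ℕ, Measurable fun x : ℕ → Ω × Bool => (∑' u, (if (∑ s ∈ Finset.range u, (if (x (s + 1)).2 then (1 : ℕ) else 0)) = i + 1 then (1 : ℝ) else 0) * f (x u).1) := fun i =>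
    measurable_tourSum (Ω := Ω) (ψ := fun p _ => f p.1) (hf.comp (measurable_fst.comp measurable_fst))
      (i + 1)
  have hNm : ∀ i : ℕ, Measurable fun x : ℕ → Ω × Bool => (∑' u, (if (∑ s ∈ Finset.range u, (if (x (s + 1)).2 then (1 : ℕ) else 0)) = i + 1 then (1 : ℝ) else 0)) := fun i =>
    Measurable.tsum fun u => measurable_headCountIndicator u (i + 1)
  have hSYm : ∀ R : ℕ, Measurable fun x : ℕ → Ω × Bool => (∑ i ∈ Finset.range R, (∑' u, (if (∑ s ∈ Finset.range u, (if (x (s + 1)).2 then (1 : ℕ) else 0)) = i + 1 then (1 : ℝ) else 0) * f (x u).1)) := fun R =>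
    Finset.measurable_sum _ fun i _ => hYm i
  have hSNm : ∀ R : ℕ, Measurable fun x : ℕ → Ω × Bool => (∑ i ∈ Finset.range R, (∑' u, (if (∑ s ∈ Finset.range u, (if (x (s + 1)).2 then (1 : ℕ) else 0)) = i + 1 then (1 : ℝ) else 0))) := fun R =>
    Finset.measurable_sum _ fun i _ => hNm i
  have hVm : ∀ R : ℕ, Measurable fun x : ℕ → Ω × Bool => ((∑ i ∈ Finset.range R, ((∑' u, (if (∑ s ∈ Finset.range u, (if (x (s + 1)).2 then (1 : ℕ) else 0)) = i + 1 then (1 : ℝ) else 0) * f (x u).1) - ((∑ i ∈ Finset.range R, (∑' u, (if (∑ s ∈ Finset.range u, (if (x (s + 1)).2 then (1 : ℕ) else 0)) = i + 1 then (1 : ℝ) else 0) * f (x u).1)) / (∑ i ∈ Finset.range R, (∑' u, (if (∑ s ∈ Finset.range u, (if (x (s + 1)).2 then (1 : ℕ) else 0)) = i + 1 then (1 : ℝ) else 0)))) * (∑' u, (if (∑ s ∈ Finset.range u, (if (x (s + 1)).2 then (1 : ℕ) else 0)) = i + 1 then (1 : ℝ) else 0))) ^ 2) / R) := fun R =>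
    (Finset.measurable_sum _ fun i _ =>
      ((hYm i).sub (((hSYm R).div (hSNm R)).mul (hNm i))).pow_const 2).div_const _
  have hTm : ∀ R : ℕ, Measurable fun x : ℕ → Ω × Bool => Real.sqrt R * (((∑ i ∈ Finset.range R, (∑' u, (if (∑ s ∈ Finset.range u, (if (x (s + 1)).2 then (1 : ℕ) else 0)) = i + 1 then (1 : ℝ) else 0) * f (x u).1)) / (∑ i ∈ Finset.range R, (∑' u, (if (∑ s ∈ Finset.range u, (if (x (s + 1)).2 then (1 : ℕ) else 0)) = i + 1 then (1 : ℝ) else 0)))) - ∫ z, f z ∂π) * ((∑ i ∈ Finset.range R, (∑' u, (if (∑ s ∈ Finset.range u, (if (x (s + 1)).2 then (1 : ℕ) else 0)) = i + 1 then (1 : ℝ) else 0))) / R) / Real.sqrt ((∑ i ∈ Finset.range R, ((∑' u, (if (∑ s ∈ Finset.range u, (if (x (s + 1)).2 then (1 : ℕ) else 0)) = i + 1 then (1 : ℝ) else 0) * f (x u).1) - ((∑ i ∈ Finset.range R, (∑' u, (if (∑ s ∈ Finset.range u, (if (x (s + 1)).2 then (1 : ℕ) else 0)) = i + 1 then (1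 : ℝ) else 0) * f (x u).1)) / (∑ i ∈ Finset.range R, (∑' u, (if (∑ s ∈ Finset.range u, (if (x (s + 1)).2 then (1 : ℕ) else 0)) = i + 1 then (1 : ℝ) else 0)))) * (∑' u, (if (∑ s ∈ Finset.range u, (if (x (s + 1)).2 then (1 : ℕ) else 0)) = i + 1 then (1 : ℝ) else 0))) ^ 2) / R) := fun R =>
    ((measurable_const.mul (((hSYm R).div (hSNm R)).sub_const _)).mul
      ((hSNm R).div_const _)).div (Real.continuous_sqrt.measurable.comp (hVm R))
  -- (1) the CLT for the centred tour sums, limit `√v · Y`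
  have hY₁ : HasLaw (fun ω => Real.sqrt (σ2 / ε.toReal) * Y ω)
      (gaussianReal 0 (σ2 / ε.toReal).toNNReal) P' := by
    refine ⟨hY.aemeasurable.const_mul _, ?_⟩
    rw [show (fun ω => Real.sqrt (σ2 / ε.toReal) * Y ω)
        = (fun a : ℝ => Real.sqrt (σ2 / ε.toReal) * a) ∘ Y from rfl,
      ← AEMeasurable.map_map_of_aemeasurable (measurable_const_mul _).aemeasurable hY.aemeasurable,
      hY.map_eq, gaussianReal_map_const_mul, mul_zero, mul_one]
    congr 1
    apply NNReal.coe_injective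
    rw [NNReal.coe_mk, Real.coe_toNNReal _ hv0.le, Real.sq_sqrt hv0.le]
  have hcltZ := splitChain_centredTourSum_clt κs μs (κ := κ) (ν := ν) (hmin := hmin) hπ hε0 hε hκs hf
    hC hY₁
  -- (2) the plug-in variance converges in probability
  have hV := regenerative_variance_plugIn_tendstoInMeasure κs μs (κ := κ) (ν := ν) (hmin := hmin) hπ
    hε0 hε hκs hf hC
  rw [← hP] at hV
  -- (3) Slutsky with the continuous map `(a, w) ↦ a / √(max(w, v/4))`
  have hgc : Continuous fun p : ℝ × ℝ => p.1 / Real.sqrt (max p.2 (σ2 / ε.toReal / 4)) := by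
    refine continuous_fst.div ((continuous_snd.max continuous_const).sqrt) fun p => ?_
    exact (Real.sqrt_pos.2 (lt_max_of_lt_right (by positivity))).ne'
  have hS := hcltZ.continuous_comp_prodMk_of_tendstoInMeasure_const hgc hV
    (fun R => (hVm R).aemeasurable)
  have hS' := hS.congr (fun R => EventuallyEq.rfl) (ae_of_all _ fun ω => (by
    show Real.sqrt (σ2 / ε.toReal) * Y ω / Real.sqrt (max (σ2 / ε.toReal) (σ2 / ε.toReal / 4))
      = Y ω
    rw [max_eq_left (by linarith), mul_div_cancel_left₀ _ hsv]))
  -- (4) `T_R` differs from the Slutsky statistic only where `V̂_R < v/4` (or tours fail to end)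
  refine tendstoInDistribution_of_tendstoInMeasure_sub _ Y hS' ?_ (fun R => (hTm R).aemeasurable)
  have hae := splitChain_ae_tourStart κs μs (κ := κ) (ν := ν) (hmin := hmin) hε0 hε hκs
  rw [← hP] at hae
  have hNbad : P.real {x : ℕ → Ω × Bool | ¬ ∀ j : ℕ, ∃ t : ℕ,
      (∑ s ∈ Finset.range t, (if (x (s + 1)).2 then (1 : ℕ) else 0)) = j ∧ (x (t + 1)).2 = true}
      = 0 := by
    rw [measureReal_def, ae_iff.1 hae, ENNReal.toReal_zero]
  rw [tendstoInMeasure_iff_measureReal_norm]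
  intro δ hδ
  have hV' := (tendstoInMeasure_iff_measureReal_norm.1 hV) (3 * (σ2 / ε.toReal) / 4) (by positivity)
  refine squeeze_zero' (Eventually.of_forall fun R => measureReal_nonneg)
    (Eventually.of_forall fun R => ?_) hV'
  -- pathwise algebra
  have aux : ∀ t a b cc : ℝ, 0 < t → 0 < b →
      t * (a / b - cc) * (b / t ^ 2) = t⁻¹ * (a - cc * b) := by
    intro t a b cc ht hb
    field_simp
  calc P.real {x | δ ≤ ‖((fun (R : ℕ) (x : ℕ → Ω × Bool) =>
          Real.sqrt R * (((∑ i ∈ Finset.range R, (∑' u, (if (∑ s ∈ Finset.range u, (if (x (s + 1)).2 then (1 : ℕ) else 0)) = i + 1 then (1 : ℝ) else 0) * f (x u).1)) / (∑ i ∈ Finset.range R, (∑' u, (if (∑ s ∈ Finset.range u, (if (x (s + 1)).2 then (1 : ℕ) else 0)) = i + 1 then (1 : ℝ) else 0)))) - ∫ z, f z ∂π) * ((∑ i ∈ Finset.range R, (∑' u, (if (∑ s ∈ Finset.range u, (if (x (s + 1)).2 then (1 : ℕ) else 0)) = i + 1 then (1 : ℝ) else 0))) / R) / Real.sqrt ((∑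 i ∈ Finset.range R, ((∑' u, (if (∑ s ∈ Finset.range u, (if (x (s + 1)).2 then (1 : ℕ) else 0)) = i + 1 then (1 : ℝ) else 0) * f (x u).1) - ((∑ i ∈ Finset.range R, (∑' u, (if (∑ s ∈ Finset.range u, (if (x (s + 1)).2 then (1 : ℕ) else 0)) = i + 1 then (1 : ℝ) else 0) * f (x u).1)) / (∑ i ∈ Finset.range R, (∑' u, (if (∑ s ∈ Finset.range u, (if (x (s + 1)).2 then (1 : ℕ) else 0)) = i + 1 then (1 : ℝ) else 0)))) * (∑' u, (if (∑ s ∈ Finset.range u, (if (x (s + 1)).2 then (1 : ℕ) else 0)) = i + 1 then (1 : ℝ) else 0))) ^ 2) / R))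
        - (fun (R : ℕ) (x : ℕ → Ω × Bool) =>
          (Real.sqrt R)⁻¹ * (∑ i ∈ Finset.range R, (∑' u, (if (∑ s ∈ Finset.range u, (if (x (s + 1)).2 then (1 : ℕ) else 0)) = i + 1 then (1 : ℝ) else 0) * (f (x u).1 - ∫ z, f z ∂π)))
            / Real.sqrt (max ((∑ i ∈ Finset.range R, ((∑' u, (if (∑ s ∈ Finset.range u, (if (x (s + 1)).2 then (1 : ℕ) else 0)) = i + 1 then (1 : ℝ) else 0) * f (x u).1) - ((∑ i ∈ Finset.range R, (∑' u, (if (∑ s ∈ Finset.range u, (if (x (s + 1)).2 then (1 : ℕ) else 0)) = i + 1 then (1 : ℝ) else 0) * f (x u).1)) / (∑ i ∈ Finset.range R, (∑' u, (if (∑ s ∈ Finset.range u, (if (x (s + 1)).2 then (1 : ℕ) else 0)) = i + 1 then (1 : ℝ) else 0)))) * (∑' u, (if (∑ s ∈ Finset.range u, (if (x (s + 1)).2 then (1 : ℕ) else 0)) = i + 1 then (1 : ℝ) else 0))) ^ 2) / R) (σ2 / ε.toReal / 4)))) R x - (0 : ℕ → (ℕ → Ω × Bool) → ℝ) R x‖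}
      ≤ P.real ({x | 3 * (σ2 / ε.toReal) / 4 ≤ ‖((∑ i ∈ Finset.range R, ((∑' u, (if (∑ s ∈ Finset.range u, (if (x (s + 1)).2 then (1 : ℕ) else 0)) = i + 1 then (1 : ℝ) else 0) * f (x u).1) - ((∑ i ∈ Finset.range R, (∑' u, (if (∑ s ∈ Finset.range u, (if (x (s + 1)).2 then (1 : ℕ) else 0)) = i + 1 then (1 : ℝ) else 0) * f (x u).1)) / (∑ i ∈ Finset.range R, (∑' u, (if (∑ s ∈ Finset.range u, (if (x (s + 1)).2 then (1 : ℕ) else 0)) = i + 1 then (1 : ℝ) else 0)))) * (∑' u, (if (∑ s ∈ Finset.range u, (if (x (s + 1)).2 then (1 : ℕ) else 0)) = i + 1 then (1 : ℝ) else 0))) ^ 2) / R) - σ2 / ε.toReal‖}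
          ∪ {x : ℕ → Ω × Bool | ¬ ∀ j : ℕ, ∃ t : ℕ,
            (∑ s ∈ Finset.range t, (if (x (s + 1)).2 then (1 : ℕ) else 0)) = j
              ∧ (x (t + 1)).2 = true}) := by
        refine measureReal_mono fun x hx => ?_
        simp only [Set.mem_setOf_eq, Pi.sub_apply, Pi.zero_apply, sub_zero] at hx
        rw [Set.mem_union, Set.mem_setOf_eq, Set.mem_setOf_eq]
        by_contra hcon
        push Not at hcon
        obtain ⟨hVgood, hgood⟩ := hcon
        rw [Real.norm_eq_abs, abs_lt] at hVgood
        have hmax : max ((∑ i ∈ Finset.range R, ((∑' u, (if (∑ s ∈ Finset.range u, (if (x (s + 1)).2 then (1 : ℕ) else 0)) = i + 1 then (1 : ℝ) else 0) * f (x u).1) - ((∑ i ∈ Finset.range R, (∑' u, (if (∑ s ∈ Finset.range u, (if (x (s + 1)).2 then (1 : ℕ) else 0)) = i + 1 then (1 : ℝ) else 0) * f (x u).1)) / (∑ i ∈ Finset.range R, (∑' u, (if (∑ s ∈ Finset.range u, (if (x (s + 1)).2 then (1 : ℕ) else 0)) = i + 1 then (1 : ℝ) else 0)))) * (∑' u,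 (if (∑ s ∈ Finset.range u, (if (x (s + 1)).2 then (1 : ℕ) else 0)) = i + 1 then (1 : ℝ) else 0))) ^ 2) / R) (σ2 / ε.toReal / 4) = ((∑ i ∈ Finset.range R, ((∑' u, (if (∑ s ∈ Finset.range u, (if (x (s + 1)).2 then (1 : ℕ) else 0)) = i + 1 then (1 : ℝ) else 0) * f (x u).1) - ((∑ i ∈ Finset.range R, (∑' u, (if (∑ s ∈ Finset.range u, (if (x (s + 1)).2 then (1 : ℕ) else 0)) = i + 1 then (1 : ℝ) else 0) * f (x u).1)) / (∑ i ∈ Finset.range R, (∑' u, (if (∑ s ∈ Finset.range u, (if (x (s + 1)).2 then (1 : ℕ) else 0)) = i + 1 then (1 : ℝ) else 0)))) * (∑' u, (if (∑ s ∈ Finset.range u, (if (x (s + 1)).2 then (1 : ℕ) else 0)) = i + 1 then (1 : ℝ) else 0))) ^ 2) / R) :=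
          max_eq_left (by linarith [hVgood.1])
        -- the two statistics agree at `x`
        have heq : Real.sqrt R * (((∑ i ∈ Finset.range R, (∑' u, (if (∑ s ∈ Finset.range u, (if (x (s + 1)).2 then (1 : ℕ) else 0)) = i + 1 then (1 : ℝ) else 0) * f (x u).1)) / (∑ i ∈ Finset.range R, (∑' u, (if (∑ s ∈ Finset.range u, (if (x (s + 1)).2 then (1 : ℕ) else 0)) = i + 1 then (1 : ℝ) else 0)))) - ∫ z, f z ∂π) * ((∑ i ∈ Finset.range R, (∑' u, (if (∑ s ∈ Finset.range u, (if (x (s + 1)).2 then (1 : ℕ) else 0)) = i + 1 then (1 : ℝ) else 0))) / R) / Real.sqrt ((∑ i ∈ Finset.range R, ((∑' u, (if (∑ s ∈ Finset.range u, (if (x (s + 1)).2 then (1 : ℕ) else 0)) = i + 1 then (1 : ℝ) else 0) * f (x u).1) - ((∑ i ∈ Finset.range R, (∑' u, (if (∑ s ∈ Finset.range u, (if (x (s + 1)).2 then (1 : ℕ) else 0)) = i + 1 then (1 : ℝ) else 0) * f (x u).1)) / (∑ i ∈ Finset.range R, (∑' u, (if (∑ s ∈ Finset.range u, (if (x (s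 + 1)).2 then (1 : ℕ) else 0)) = i + 1 then (1 : ℝ) else 0)))) * (∑' u, (if (∑ s ∈ Finset.range u, (if (x (s + 1)).2 then (1 : ℕ) else 0)) = i + 1 then (1 : ℝ) else 0))) ^ 2) / R)
            = (Real.sqrt R)⁻¹ * (∑ i ∈ Finset.range R, (∑' u, (if (∑ s ∈ Finset.range u, (if (x (s + 1)).2 then (1 : ℕ) else 0)) = i + 1 then (1 : ℝ) else 0) * (f (x u).1 - ∫ z, f z ∂π)))
              / Real.sqrt (max ((∑ i ∈ Finset.range R, ((∑' u, (if (∑ s ∈ Finset.range u, (if (x (s + 1)).2 then (1 : ℕ) else 0)) = i + 1 then (1 : ℝ) else 0) * f (x u).1) - ((∑ i ∈ Finset.range R, (∑' u, (if (∑ s ∈ Finset.range u, (if (x (s + 1)).2 then (1 : ℕ) else 0)) = i + 1 then (1 : ℝ) else 0) * f (x u).1)) / (∑ i ∈ Finset.range R, (∑' u, (if (∑ s ∈ Finset.range u, (if (x (s + 1)).2 then (1 : ℕ) else 0)) = i + 1 then (1 : ℝ) else 0)))) * (∑' u, (if (∑ s ∈ Finset.range u, (if (x (s + 1)).2 then (1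 : ℕ) else 0)) = i + 1 then (1 : ℝ) else 0))) ^ 2) / R) (σ2 / ε.toReal / 4)) := by
          rw [hmax]
          rcases Nat.eq_zero_or_pos R with hR | hR
          · subst hR
            simp
          congr 1
          have hN1 : ∀ i : ℕ, (1 : ℝ) ≤ (∑' u, (if (∑ s ∈ Finset.range u, (if (x (s + 1)).2 then (1 : ℕ) else 0)) = i + 1 then (1 : ℝ) else 0)) := fun i => by
            obtain ⟨t₀, ht₀, hh₀⟩ := hgood i
            obtain ⟨t₁, ht₁, hh₁⟩ := hgood (i + 1)
            exact one_le_tourLength x ht₀ hh₀ ht₁ hh₁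
          have hZ : ∀ i : ℕ, (∑' u, (if (∑ s ∈ Finset.range u, (if (x (s + 1)).2 then (1 : ℕ) else 0)) = i + 1 then (1 : ℝ) else 0) * (f (x u).1 - ∫ z, f z ∂π)) = (∑' u, (if (∑ s ∈ Finset.range u, (if (x (s + 1)).2 then (1 : ℕ) else 0)) = i + 1 then (1 : ℝ) else 0) * f (x u).1) - c * (∑' u, (if (∑ s ∈ Finset.range u, (if (x (s + 1)).2 then (1 : ℕ) else 0)) = i + 1 then (1 : ℝ) else 0)) := fun i => by
            obtain ⟨t₁, ht₁, hh₁⟩ := hgood (i + 1)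
            rw [tourSum_eq_finsetSum (fun p _ => f p.1 - c) x le_rfl ht₁ hh₁,
              tourSum_eq_finsetSum (fun p _ => f p.1) x le_rfl ht₁ hh₁,
              tourLength_eq_finsetSum x le_rfl ht₁ hh₁, Finset.mul_sum, ← Finset.sum_sub_distrib]
            exact Finset.sum_congr rfl fun u _ => by ring
          have hSZ : (∑ i ∈ Finset.range R, (∑' u, (if (∑ s ∈ Finset.range u, (if (x (s + 1)).2 then (1 : ℕ) else 0)) = i + 1 then (1 : ℝ) else 0) * (f (x u).1 - ∫ z, f z ∂π))) = (∑ i ∈ Finset.range R, (∑' u, (if (∑ s ∈ Finset.range u, (if (x (s + 1)).2 then (1 : ℕ) else 0)) = i + 1 then (1 : ℝ) else 0) * f (x u).1)) - c * (∑ i ∈ Finset.range R, (∑' u, (if (∑ s ∈ Finset.range u, (if (x (s + 1)).2 then (1 : ℕ) else 0)) = i + 1 then (1 : ℝ) else 0))) := by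
            rw [Finset.sum_congr rfl fun i _ => hZ i, Finset.sum_sub_distrib, ← Finset.mul_sum]
          have hR0 : (0 : ℝ) < R := Nat.cast_pos.2 hR
          have hRS : (R : ℝ) ≤ (∑ i ∈ Finset.range R, (∑' u, (if (∑ s ∈ Finset.range u, (if (x (s + 1)).2 then (1 : ℕ) else 0)) = i + 1 then (1 : ℝ) else 0))) := by
            calc (R : ℝ) = ∑ i ∈ Finset.range R, (1 : ℝ) := by simp
              _ ≤ (∑ i ∈ Finset.range R, (∑' u, (if (∑ s ∈ Finset.range u, (if (x (s + 1)).2 then (1 : ℕ) else 0)) = i + 1 then (1 : ℝ) else 0))) := Finset.sum_le_sum fun i _ => hN1 i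
          have hSN0 : 0 < (∑ i ∈ Finset.range R, (∑' u, (if (∑ s ∈ Finset.range u, (if (x (s + 1)).2 then (1 : ℕ) else 0)) = i + 1 then (1 : ℝ) else 0))) := hR0.trans_le hRS
          have h := aux (Real.sqrt R) (∑ i ∈ Finset.range R, (∑' u, (if (∑ s ∈ Finset.range u, (if (x (s + 1)).2 then (1 : ℕ) else 0)) = i + 1 then (1 : ℝ) else 0) * f (x u).1)) (∑ i ∈ Finset.range R, (∑' u, (if (∑ s ∈ Finset.range u, (if (x (s + 1)).2 then (1 : ℕ) else 0)) = i + 1 then (1 : ℝ) else 0))) c (Real.sqrt_pos.2 hR0) hSN0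
          rw [Real.sq_sqrt hR0.le] at h
          rw [hSZ]
          exact h
        rw [heq, sub_self, norm_zero] at hx
        exact absurd hx (not_le.2 hδ)
    _ ≤ P.real {x | 3 * (σ2 / ε.toReal) / 4 ≤ ‖((∑ i ∈ Finset.range R, ((∑' u, (if (∑ s ∈ Finset.range u, (if (x (s + 1)).2 then (1 : ℕ) else 0)) = i + 1 then (1 : ℝ) else 0) * f (x u).1) - ((∑ i ∈ Finset.range R, (∑' u, (if (∑ s ∈ Finset.range u, (if (x (s + 1)).2 then (1 : ℕ) else 0)) = i + 1 then (1 : ℝ) else 0) * f (x u).1)) / (∑ i ∈ Finset.range R, (∑' u, (if (∑ s ∈ Finset.range u, (if (x (s + 1)).2 then (1 : ℕ) else 0)) = i + 1 then (1 : ℝ) else 0)))) * (∑' u, (if (∑ s ∈ Finset.range u, (if (x (s + 1)).2 then (1 : ℕ) else 0)) = i + 1 then (1 : ℝ) else 0))) ^ 2) / R) - σ2 / ε.toReal‖}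
          + P.real {x : ℕ → Ω × Bool | ¬ ∀ j : ℕ, ∃ t : ℕ,
            (∑ s ∈ Finset.range t, (if (x (s + 1)).2 then (1 : ℕ) else 0)) = j
              ∧ (x (t + 1)).2 = true} := measureReal_union_le _ _
    _ = P.real {x | 3 * (σ2 / ε.toReal) / 4 ≤ ‖((∑ i ∈ Finset.range R, ((∑' u, (if (∑ s ∈ Finset.range u, (if (x (s + 1)).2 then (1 : ℕ) else 0)) = i + 1 then (1 : ℝ) else 0) * f (x u).1) - ((∑ i ∈ Finset.range R, (∑' u, (if (∑ s ∈ Finset.range u, (if (x (s + 1)).2 then (1 : ℕ) else 0)) = i + 1 then (1 : ℝ) else 0) * f (x u).1)) / (∑ i ∈ Finset.range R, (∑' u, (if (∑ s ∈ Finset.range u, (if (x (s + 1)).2 then (1 : ℕ) else 0)) = i + 1 then (1 : ℝ) else 0)))) * (∑' u, (if (∑ s ∈ Finset.range u, (if (x (s + 1)).2 then (1 : ℕ) else 0)) = i + 1 then (1 : ℝ) else 0))) ^ 2) / R) - σ2 / ε.toReal‖} := by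
        rw [hNbad, add_zero]

/-- **ASYMPTOTICALLY EXACT COVERAGE OF THE STUDENTISED REGENERATIVE INTERVAL.**  Under the
hypotheses of `regenerative_studentized_clt`, for every `z > 0`:
`P̂(|T_R| ≤ z) → (gaussianReal 0 1) [−z, z]` — the interval `Â_R ± z √V̂_R / (N̄_R √R)` covers
`π(f)` with probability tending to the nominal Gaussian value. -/
theorem regenerative_studentized_coverage {π : Measure Ω} [IsProbabilityMeasure π]
    (hπ : Kernel.Invariant κ π) (hε0 : 0 < ε) (hε : ε < 1)
    (hκs : ∀ p, κs p = (ε • ν).map (fun y : Ω => (y, true))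
      + ((1 - ε) • Doeblin.residualKernel κ ν ε hmin p.1).map (fun y : Ω => (y, false)))
    {f : Ω → ℝ} (hf : Measurable f) {C : ℝ} (hC : ∀ x, |f x| ≤ C)
    (hσ : 0 < ((∫ y, (f y - ∫ z, f z ∂π) ^ 2 ∂π)
      + 2 * ∑' k, ∫ y, (f y - ∫ z, f z ∂π) * (kop κ)^[k + 1] (fun y => f y - ∫ z, f z ∂π) y ∂π)) {z : ℝ} (hz : 0 < z) :
    Tendsto (fun R : ℕ => ((Kernel.trajMeasure (X := fun _ : ℕ => Ω × Bool) μs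
        (fun m : ℕ => κs.comap (fun h : (i : ↥(Finset.Iic m)) → Ω × Bool =>
          h ⟨m, Finset.mem_Iic.2 le_rfl⟩) (measurable_pi_apply _)))).real
      {x | |Real.sqrt R * (((∑ i ∈ Finset.range R, (∑' u, (if (∑ s ∈ Finset.range u, (if (x (s + 1)).2 then (1 : ℕ) else 0)) = i + 1 then (1 : ℝ) else 0) * f (x u).1)) / (∑ i ∈ Finset.range R, (∑' u, (if (∑ s ∈ Finset.range u, (if (x (s + 1)).2 then (1 : ℕ) else 0)) = i + 1 then (1 : ℝ) else 0)))) - ∫ z, f z ∂π) * ((∑ i ∈ Finset.range R, (∑' u, (if (∑ s ∈ Finset.range u, (if (x (s + 1)).2 then (1 : ℕ) else 0)) = i + 1 then (1 : ℝ) else 0))) / R) / Real.sqrt ((∑ i ∈ Finset.range R, ((∑' u, (if (∑ s ∈ Finset.range u, (if (x (s + 1)).2 then (1 : ℕ) else 0)) = i + 1 then (1 : ℝ) else 0) * f (x u).1) - ((∑ i ∈ Finset.range R, (∑' u, (if (∑ s ∈ Finset.range u, (if (x (s + 1)).2 then (1 : ℕ) else 0)) = i + 1 then (1 : ℝ) else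 0) * f (x u).1)) / (∑ i ∈ Finset.range R, (∑' u, (if (∑ s ∈ Finset.range u, (if (x (s + 1)).2 then (1 : ℕ) else 0)) = i + 1 then (1 : ℝ) else 0)))) * (∑' u, (if (∑ s ∈ Finset.range u, (if (x (s + 1)).2 then (1 : ℕ) else 0)) = i + 1 then (1 : ℝ) else 0))) ^ 2) / R)| ≤ z})
      atTop (𝓝 ((gaussianReal 0 1).real (Set.Icc (-z) z))) := by
  haveI hPI : IsProbabilityMeasure (Kernel.trajMeasure (X := fun _ : ℕ => Ω × Bool) μs
        (fun m : ℕ => κs.comap (fun h : (i : ↥(Finset.Iic m)) → Ω × Bool =>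
          h ⟨m, Finset.mem_Iic.2 le_rfl⟩) (measurable_pi_apply _))) := inferInstance
  have hY : HasLaw (fun a : ℝ => a) (gaussianReal 0 1) (gaussianReal 0 1) :=
    ⟨aemeasurable_id', Measure.map_id'⟩
  have hclt := regenerative_studentized_clt κs μs (κ := κ) (ν := ν) (hmin := hmin) hπ hε0 hε hκs hf hC
    hσ hY
  have hE : ((gaussianReal 0 1).map (fun a : ℝ => a)) (frontier (Set.Icc (-z) z)) = 0 := by
    rw [Measure.map_id', frontier_Icc (by linarith)]
    haveI := nullSingletonClass_gaussianReal (μ := 0) one_ne_zero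
    exact (Set.toFinite _).measure_zero _
  have key := ProbabilityMeasure.tendsto_measure_of_null_frontier_of_tendsto' hclt.tendsto hE
  have hset : ∀ R : ℕ, (((Kernel.trajMeasure (X := fun _ : ℕ => Ω × Bool) μs
        (fun m : ℕ => κs.comap (fun h : (i : ↥(Finset.Iic m)) → Ω × Bool =>
          h ⟨m, Finset.mem_Iic.2 le_rfl⟩) (measurable_pi_apply _)))).map
        (fun x : ℕ → Ω × Bool => Real.sqrt R * (((∑ i ∈ Finset.range R, (∑' u, (if (∑ s ∈ Finset.range u, (if (x (s + 1)).2 then (1 : ℕ) else 0)) = i + 1 then (1 : ℝ) else 0) * f (x u).1)) / (∑ i ∈ Finset.range R, (∑' u, (if (∑ s ∈ Finset.range u, (if (x (s + 1)).2 then (1 : ℕ) else 0)) = i + 1 then (1 : ℝ) else 0)))) - ∫ z, f z ∂π) * ((∑ i ∈ Finset.range R, (∑' u, (if (∑ s ∈ Finset.range u, (if (x (s + 1)).2 then (1 : ℕ) else 0)) = i + 1 then (1 : ℝ) else 0))) / R) / Real.sqrt ((∑ i ∈ Finset.range R, ((∑' u, (if (∑ s ∈ Finset.range u, (if (x (s +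 1)).2 then (1 : ℕ) else 0)) = i + 1 then (1 : ℝ) else 0) * f (x u).1) - ((∑ i ∈ Finset.range R, (∑' u, (if (∑ s ∈ Finset.range u, (if (x (s + 1)).2 then (1 : ℕ) else 0)) = i + 1 then (1 : ℝ) else 0) * f (x u).1)) / (∑ i ∈ Finset.range R, (∑' u, (if (∑ s ∈ Finset.range u, (if (x (s + 1)).2 then (1 : ℕ) else 0)) = i + 1 then (1 : ℝ) else 0)))) * (∑' u, (if (∑ s ∈ Finset.range u, (if (x (s + 1)).2 then (1 : ℕ) else 0)) = i + 1 then (1 : ℝ) else 0))) ^ 2) / R))) (Set.Icc (-z) z)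
      = ((Kernel.trajMeasure (X := fun _ : ℕ => Ω × Bool) μs
        (fun m : ℕ => κs.comap (fun h : (i : ↥(Finset.Iic m)) → Ω × Bool =>
          h ⟨m, Finset.mem_Iic.2 le_rfl⟩) (measurable_pi_apply _))))
        {x | |Real.sqrt R * (((∑ i ∈ Finset.range R, (∑' u, (if (∑ s ∈ Finset.range u, (if (x (s + 1)).2 then (1 : ℕ) else 0)) = i + 1 then (1 : ℝ) else 0) * f (x u).1)) / (∑ i ∈ Finset.range R, (∑' u, (if (∑ s ∈ Finset.range u, (if (x (s + 1)).2 then (1 : ℕ) else 0)) = i + 1 then (1 : ℝ) else 0)))) - ∫ z, f z ∂π) * ((∑ i ∈ Finset.range R, (∑' u, (if (∑ s ∈ Finset.range u, (if (x (s + 1)).2 then (1 : ℕ) else 0)) = i + 1 then (1 : ℝ) else 0))) / R) / Real.sqrt ((∑ i ∈ Finset.range R, ((∑' u, (if (∑ s ∈ Finset.range u, (if (x (s + 1)).2 then (1 : ℕ) else 0)) = i + 1 then (1 : ℝ) else 0) * f (x u).1) - ((∑ i ∈ Finset.range R, (∑' u, (if (∑ s ∈ Finset.range u, (if (x (s + 1)).2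 then (1 : ℕ) else 0)) = i + 1 then (1 : ℝ) else 0) * f (x u).1)) / (∑ i ∈ Finset.range R, (∑' u, (if (∑ s ∈ Finset.range u, (if (x (s + 1)).2 then (1 : ℕ) else 0)) = i + 1 then (1 : ℝ) else 0)))) * (∑' u, (if (∑ s ∈ Finset.range u, (if (x (s + 1)).2 then (1 : ℕ) else 0)) = i + 1 then (1 : ℝ) else 0))) ^ 2) / R)| ≤ z} := by
    intro R
    rw [Measure.map_apply_of_aemeasurable (hclt.forall_aemeasurable R) measurableSet_Icc]
    congr 1
    ext x
    simp only [Set.mem_preimage, Set.mem_Icc, Set.mem_setOf_eq, abs_le]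
  have key' := (ENNReal.tendsto_toReal (measure_ne_top _ (Set.Icc (-z) z))).comp key
  simp only [ProbabilityMeasure.coe_mk, Function.comp_def, hset, Measure.map_id'] at key'
  simp only [measureReal_def]
  exact key'

end Studentized

end Summit.Ventures.LatticeQCDFlow.Scoring

end
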